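import Summits.QuantumFields.BalabanUV.T4Continuum.Support.VariationalVectorOneMinCentredBracket
import Summits.QuantumFields.BalabanUV.T4Continuum.Support.VariationalVectorRegularityCovariant

/-!
# T⁴ programme, spine node NE2 (U1a), lane P2 — «V-ONE-G SUMMABLE», file E: THE MONOTONE END INSTANTIATED — EXISTENCE OF THE VECTOR TOWER LIMIT FOR
# BAŁABAN's PROJECTED FUNCTIONAL WITH THE CENTRED COMPETITOR, modulo the displayed leaves, the END's COMP data and the summability of the explicit defects
# (model level, `E = ℂ`; cell `pub-balaban`)

NE2 formalisation swarm `b2b-balaban-t4-ne2-formalise-*`, leaf prover 01 GEN 9 (`prover-b2b-balaban-t4-ne2-formalise-leaf-01-g9-0`); journal INTENT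
CLAIMS.log 2026-08-20 l.21359.  On top of leaf-10-g3's monotone END `VariationalVectorEndMonotone.effV_tendsto_of_upper` (p226720), files B ∕ D of this item
(`hONEm_centred_reg`, `hREG_action`, `epsStar_nonneg`) and leaf-03-g6's matrix form of Bałaban's functional (`VariationalVectorRegularityCovariant.GmProj`,
`GmProj_posSemidef`, `projG_eq_qform`, p228016) BY NAME; nothing defined.

WHAT.  **`effV_tendsto_centred`**: along `n_k = L^k`, for unitary bond transports `R k` (coarse, plaquette defect `≤ p k`) and `R′ k` (one step finer), unitary
scalar frames `Tsc k` ∕ `Tsc′ k`, contractive vector line transports `T k`, with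
`G k := projG (R k) (ker Q_{Tsc k})`, `G′ k := projG (R′ k) (ker (Q_{Tsc k} ∘ Q_{Tsc′ k}))`, `Gm k := GmProj (R k) (ker Q_{Tsc k})` (`hGm` ∕ `hG` DISCHARGED),
one-step vector carriers `frameT L (fine (L^k) M) (Tsc′ k) (R k)` (the centred competitor's), and DISPLAYED per level, all in landed shapes: the END's COMP data
(`hTcomp`, `hRtr`, `hGtr` — transport identities NOT proved here), mismatch `m k`, frame defect `m₁ k`, the scalar pair's UB⁺ (both levels) ∕ P⁺ (both) ∕ REG⁺,
vector V-UB coarse `Λ_V k` ∕ fine `Λᵥ k`, V-P, (Går), (GF3), V-REG, free `s k, t k, u k > 0`, and BOUNDED PARTIAL SUMS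
`Σ_{k<K} ePV (Λ_V k) (C_Pᵛ k) 1 (ε⋆ k) (δ′ k) ≤ S` (`ε⋆ k` = file B's coefficient at level k, written out as a `let`; `δ′ k = √(8d(1+d²))·(L^k·L·m₁ k)`):
THE CONCLUSION OF THE END VERBATIM — the effective operators `effV (L^k) M (R k) (Gm k) (QmL (L^k) M (T k)) a` converge to a Hermitian limit with nonnegative
form and the block-spin values of `ScV (R k) (G k)` over the fibres of `QvL (T k)` converge to its form.  Proof = `effV_tendsto_of_upper` with
`hONEm k := hONEm_centred_reg (L^k) …`, `hREG k := hREG_action`, `hε₁ k := epsStar_nonneg`; **`effV_tendsto_centred_geom`**: the same with the partial-sum hypothesis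
replaced by uniform `Λ_V⋆, C_P⋆` and geometric decay `ε⋆ k ≤ c_ε θ^k`, `δ′ k ≤ c_δ θ^k` (`effV_tendsto_of_upper_geom`; file C's `epsStar_class_le` supplies the first in
the class `η_k = c·θ^{2k}`).

HONEST FRAMING (T4-DAG p. 1).  An INSTANTIATION at MODEL level (c5; transports ∕ frames ∕ carriers DATA; `E = ℂ`) modulo displayed leaves + COMP data +
summability — NOT «V-END with background proved»; [folklore] plumbing; no `def`, no `def … : Prop`, no `sorry`; axioms standard.  NE2 NOT proved; NE3 OPEN;
spine PROVED 0∕9 unchanged; rung (B)+1 on a fixed finite T⁴ — NOT infinite volume, NOT mass gap, NOT Clay.  HONEST DEPENDENCY (cell, verbatim): continuum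
YM on T⁴ ⇐ BetaPertH ∧ nine spine estimates (0/9 proved); BetaPertH ⇐ (D1) ∧ (D4) ∧ CAP+tail; G-an2-4 gates asym, D1 and NE2/3/4.
-/

noncomputable section

namespace Summit.QuantumFields.BalabanUV.T4Continuum.VariationalVectorEndCentred

open Finset Filter WithLp
open scoped Topology
open Literature.MathematicalPhysics.QuantumFieldTheory.Balaban1983to89
open Literature.MathematicalPhysics.QuantumFieldTheory.Balaban1983to89.B5Prop11Plancherel (Tor fine unitVec)
open Literature.MathematicalPhysics.QuantumFieldTheory.Balaban1983to89.B5Block118 (bpt)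
open Literature.Analysis.Complex (qform)
open Summit.QuantumFields.BalabanUV.T4Continuum.VariationalTransfer (blockSpin)
open Summit.QuantumFields.BalabanUV.T4Continuum.VariationalColourFederbush (cDv misv)
open Summit.QuantumFields.BalabanUV.T4Continuum.VariationalColourUpperBound (nsqv)
open Summit.QuantumFields.BalabanUV.T4Continuum.VariationalColourOneStepPhys (rhov)
open Summit.QuantumFields.BalabanUV.T4Continuum.VariationalColourScalarPair (Scv Sfv qWv qVv Qkv Q1v)
open Summit.QuantumFields.BalabanUV.T4Continuum.VariationalColourTower (Rtrv)
open Summit.QuantumFields.BalabanUV.T4Continuum.VariationalVectorInterpolant (frameT)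
open Summit.QuantumFields.BalabanUV.T4Continuum.VectorBlockTrialForm (QvL nsqV nsqV_nonneg roughV compL)
open Summit.QuantumFields.BalabanUV.T4Continuum.VariationalVectorForm (ScV SfV qWV ScV_nonneg)
open Summit.QuantumFields.BalabanUV.T4Continuum.VariationalVectorWeitzenbock (divV divSq)
open Summit.QuantumFields.BalabanUV.T4Continuum.VariationalVectorGaugeSlice (sliceSub projG projG_nonneg avgOp)
open Summit.QuantumFields.BalabanUV.T4Continuum.VariationalVectorOneStep (hessV)
open Summit.QuantumFields.BalabanUV.T4Continuum.VariationalVectorOneStepPhys (rhoV)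
open Summit.QuantumFields.BalabanUV.T4Continuum.VariationalVectorEffective (unc effV)
open Summit.QuantumFields.BalabanUV.T4Continuum.VariationalVectorTower (Gtr QmL)
open Summit.QuantumFields.BalabanUV.T4Continuum.VariationalVectorEndOfLeaves (ePV)
open Summit.QuantumFields.BalabanUV.T4Continuum.VariationalVectorEndMonotone (effV_tendsto_of_upper effV_tendsto_of_upper_geom)
open Summit.QuantumFields.BalabanUV.T4Continuum.VariationalVectorRegularityCovariant (GmProj GmProj_posSemidef projG_eq_qform)
open Summit.QuantumFields.BalabanUV.T4Continuum.VariationalVectorOneMinCentredReg (hONEm_centred_reg hREG_action)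
open Summit.QuantumFields.BalabanUV.T4Continuum.VariationalVectorOneMinCentredBracket (epsStar_nonneg)

variable {d : ℕ} (L : ℕ) [NeZero L] (M : Fin d → ℕ) [hM : ∀ μ, NeZero (M μ)]

/-- **THE MONOTONE END FOR BAŁABAN's PROJECTED FUNCTIONAL WITH THE CENTRED COMPETITOR — EXISTENCE OF THE VECTOR TOWER LIMIT**, modulo the displayed
leaves, the END's COMP data and bounded partial sums of the explicit defects (see the module docstring). [folklore] -/
theorem effV_tendsto_centred (hd : 1 ≤ d)
    (R : (k : ℕ) → Tor (fine (L ^ k) M) → Fin d → (ℂ →L[ℂ] ℂ)) (R' : (k : ℕ) → Tor (fine L (fine (L ^ k) M)) → Fin d → (ℂ →L[ℂ] ℂ))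
    (Tsc : (k : ℕ) → Tor (fine (L ^ k) M) → (ℂ →L[ℂ] ℂ)) (Tsc' : (k : ℕ) → Tor (fine L (fine (L ^ k) M)) → (ℂ →L[ℂ] ℂ))
    (T : (k : ℕ) → Tor M → (Fin d → Fin (L ^ k)) → Fin (L ^ k) → Fin d → (ℂ →L[ℂ] ℂ))
    -- the END's COMP data (transport identities displayed, not proved here)
    (hTcomp : ∀ k, T (k + 1) = compL (L ^ k) L M (T k) (frameT L (fine (L ^ k) M) (Tsc' k) (R k)))
    (hRtr : ∀ k, R (k + 1) = Rtrv (L ^ k) L M (R' k))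
    (hGtr : ∀ k, projG (fine (L ^ (k + 1)) M) (R (k + 1)) (LinearMap.ker (avgOp (L ^ (k + 1)) M (Tsc (k + 1))))
      = Gtr (L ^ k) L M (projG (fine L (fine (L ^ k) M)) (R' k) (LinearMap.ker ((avgOp (L ^ k) M (Tsc k)).comp (avgOp L (fine (L ^ k) M) (Tsc' k))))))
    {a : ℝ} (ha : 0 < a)
    -- unitarity ∕ contractivity ∕ sizes per level
    (hTsc : ∀ k x, Tsc k x ∈ unitary (ℂ →L[ℂ] ℂ)) (hTsc' : ∀ k x, Tsc' k x ∈ unitary (ℂ →L[ℂ] ℂ))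
    (hR : ∀ k y μ, R k y μ ∈ unitary (ℂ →L[ℂ] ℂ)) (hR' : ∀ k x μ, R' k x μ ∈ unitary (ℂ →L[ℂ] ℂ)) (hT : ∀ k y j t' μ, ‖T k y j t' μ‖ ≤ 1)
    (p m m₁ : ℕ → ℝ) (hp : ∀ k, 0 ≤ p k)
    (hP : ∀ k x μ ν, ‖R k x μ * R k (x + unitVec (fine (L ^ k) M) μ) ν - R k x ν * R k (x + unitVec (fine (L ^ k) M) ν) μ‖ ≤ p k)
    (hm : ∀ k, 0 ≤ m k) (hmis : ∀ k y μ j, ‖misv L (fine (L ^ k) M) (R k) (R' k) (Tsc' k) y μ j‖ ≤ m k)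
    (hm₁ : ∀ k, 0 ≤ m₁ k)
    (hin : ∀ k (y : Tor (fine (L ^ k) M)) (j : Fin d → Fin L) (μ : Fin d), (j μ : ℕ) + 1 < L →
      ‖R' k (bpt L (fine (L ^ k) M) y j) μ * star (Tsc' k (bpt L (fine (L ^ k) M) y j + unitVec (fine L (fine (L ^ k) M)) μ))
        - star (Tsc' k (bpt L (fine (L ^ k) M) y j))‖ ≤ m₁ k)
    (hcross : ∀ k (y : Tor (fine (L ^ k) M)) (j : Fin d → Fin L) (μ : Fin d), (j μ : ℕ) + 1 = L →
      ‖R' k (bpt L (fine (L ^ k) M) y j) μ * star (Tsc' k (bpt L (fine (L ^ k) M) y j + unitVec (fine L (fine (L ^ k) M)) μ))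
        - star (Tsc' k (bpt L (fine (L ^ k) M) y j)) * R k y μ‖ ≤ m₁ k)
    -- the scalar pair's leaves per level
    (Λ CP CR : ℕ → ℝ) (hΛ : ∀ k, 0 ≤ Λ k) (hCP : ∀ k, 0 ≤ CP k) (hCR : ∀ k, 0 ≤ CR k)
    (hUBc : ∀ k (ψ : Tor M → ℂ), ∃ f, Qkv (L ^ k) M (Tsc k) f = ψ ∧ Scv (L ^ k) M (R k) f ≤ Λ k * nsqv ψ)
    (hUBf : ∀ k (ψ : Tor M → ℂ), ∃ g, Qkv (L ^ k) M (Tsc k) (Q1v (L ^ k) L M (Tsc' k) g) = ψ ∧ Sfv (L ^ k) L M (R' k) g ≤ Λ k * nsqv ψ)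
    (hPc : ∀ k f, qWv (L ^ k) M f ≤ CP k * (Scv (L ^ k) M (R k) f + nsqv (Qkv (L ^ k) M (Tsc k) f)))
    (hPf : ∀ k g, qVv (L ^ k) L M g ≤ CP k * (Sfv (L ^ k) L M (R' k) g + nsqv (Qkv (L ^ k) M (Tsc k) (Q1v (L ^ k) L M (Tsc' k) g))))
    (hREG : ∀ k (ψ : Tor M → ℂ) f, Qkv (L ^ k) M (Tsc k) f = ψ → (∀ f₂, Qkv (L ^ k) M (Tsc k) f₂ = ψ → Scv (L ^ k) M (R k) f ≤ Scv (L ^ k) M (R k) f₂) →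
      rhov (L ^ k) M (R k) f ≤ CR k * (Scv (L ^ k) M (R k) f + nsqv ψ))
    -- the vector leaves per level for `G k := projG (R k) (ker Q_{Tsc k})` on the carriers `QvL (T k)`
    (ΛV Λv CRv CPv CGar CGar' CD CD' : ℕ → ℝ) (hΛV : ∀ k, 0 ≤ ΛV k) (hΛv : ∀ k, 0 ≤ Λv k) (hCRv : ∀ k, 0 ≤ CRv k) (hCPv : ∀ k, 0 ≤ CPv k)
    (hCGar : ∀ k, 0 ≤ CGar k) (hCGar' : ∀ k, 0 ≤ CGar' k) (hCD : ∀ k, 0 ≤ CD k) (hCD' : ∀ k, 0 ≤ CD' k)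
    (hUBcV : ∀ k (φ : Tor M → Fin d → ℂ), ∃ W, QvL (L ^ k) M (T k) W = φ ∧
      ScV (L ^ k) M (R k) (projG (fine (L ^ k) M) (R k) (LinearMap.ker (avgOp (L ^ k) M (Tsc k)))) W ≤ ΛV k * nsqV M φ)
    (hUBfV : ∀ k (φ : Tor M → Fin d → ℂ), ∃ W', QvL (L ^ k) M (T k) (QvL L (fine (L ^ k) M) (frameT L (fine (L ^ k) M) (Tsc' k) (R k)) W') = φ ∧
      SfV (L ^ k) L M (R' k) (projG (fine L (fine (L ^ k) M)) (R' k)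
        (LinearMap.ker ((avgOp (L ^ k) M (Tsc k)).comp (avgOp L (fine (L ^ k) M) (Tsc' k))))) W' ≤ Λv k * nsqV M φ)
    (hPcV : ∀ k W, qWV (L ^ k) M W
      ≤ CPv k * (ScV (L ^ k) M (R k) (projG (fine (L ^ k) M) (R k) (LinearMap.ker (avgOp (L ^ k) M (Tsc k)))) W + nsqV M (QvL (L ^ k) M (T k) W)))
    (hGar : ∀ k W, (((L ^ k : ℕ) : ℝ) ^ d)⁻¹ * (((L ^ k : ℕ) : ℝ) ^ 2 * roughV (L ^ k) M (R k) W)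
      ≤ CGar k * ScV (L ^ k) M (R k) (projG (fine (L ^ k) M) (R k) (LinearMap.ker (avgOp (L ^ k) M (Tsc k)))) W + CGar' k * nsqV M (QvL (L ^ k) M (T k) W))
    (hGdiv : ∀ k W, (((L ^ k : ℕ) : ℝ) ^ d)⁻¹ * (((L ^ k : ℕ) : ℝ) ^ 2 * divSq (fine (L ^ k) M) (R k) W)
      ≤ CD k * ScV (L ^ k) M (R k) (projG (fine (L ^ k) M) (R k) (LinearMap.ker (avgOp (L ^ k) M (Tsc k)))) W + CD' k * nsqV M (QvL (L ^ k) M (T k) W))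
    (hREGV : ∀ k (φ : Tor M → Fin d → ℂ) W, QvL (L ^ k) M (T k) W = φ →
      (∀ W₂, QvL (L ^ k) M (T k) W₂ = φ → ScV (L ^ k) M (R k) (projG (fine (L ^ k) M) (R k) (LinearMap.ker (avgOp (L ^ k) M (Tsc k)))) W
        ≤ ScV (L ^ k) M (R k) (projG (fine (L ^ k) M) (R k) (LinearMap.ker (avgOp (L ^ k) M (Tsc k)))) W₂) →
      rhoV (L ^ k) M (R k) W ≤ CRv k * (ScV (L ^ k) M (R k) (projG (fine (L ^ k) M) (R k) (LinearMap.ker (avgOp (L ^ k) M (Tsc k)))) W + nsqV M φ))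
    (s t u : ℕ → ℝ) (hs : ∀ k, 0 < s k) (ht : ∀ k, 0 < t k) (hu : ∀ k, 0 < u k) {S : ℝ} :
    let eH : ℕ → ℝ := fun k => (((d : ℝ) / 4 + 1 / 2) * ((L : ℝ) / ((L ^ k : ℕ) : ℝ) ^ 2)) * (CR k) * ((Λ k) + 1)
        + 2 * (Real.sqrt (2 * d * (1 + (d : ℝ) ^ 2)) * (((L ^ k : ℕ) : ℝ) * L * (m₁ k)))
          * Real.sqrt (((Λ k) + (((d : ℝ) / 4 + 1 / 2) * ((L : ℝ) / ((L ^ k : ℕ) : ℝ) ^ 2)) * (CR k) * ((Λ k) + 1)) * ((CP k) * ((Λ k) + 1)))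
        + (Real.sqrt (2 * d * (1 + (d : ℝ) ^ 2)) * (((L ^ k : ℕ) : ℝ) * L * (m₁ k))) ^ 2 * ((CP k) * ((Λ k) + 1))
        + 2 * (Real.sqrt d * (((L ^ k : ℕ) : ℝ) * (m k))) * Real.sqrt ((Λ k) * ((CP k) * ((Λ k) + 1)))
    let e₂ : ℕ → ℝ := fun k => (t k) + 3 * (1 + (t k)⁻¹) * (8 * d * ((((L ^ k : ℕ) : ℝ) ^ 2)⁻¹ * (CRv k)
          + (1 + (m₁ k)) ^ 2 * ((d : ℝ) / 4 * L * ((((L ^ k : ℕ) : ℝ) ^ 2)⁻¹ * (CRv k))) + (m₁ k) ^ 2 * ((CGar k) + (CGar' k))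
          + (m₁ k) ^ 2 * (2 * (1 + (d : ℝ) ^ 2) * (L : ℝ) ^ 2 * (((L ^ k : ℕ) : ℝ) ^ 2 * (CPv k))))
        + (d : ℝ) / 2 * (2 * d * ((((L ^ k : ℕ) : ℝ) ^ 2)⁻¹ * (CRv k)) + 2 * (d : ℝ) ^ 2 * (p k) ^ 2 * (((L ^ k : ℕ) : ℝ) ^ 2 * (CPv k)))
        + (d : ℝ) / 4 * (2 * (2 * d * ((((L ^ k : ℕ) : ℝ) ^ 2)⁻¹ * (CRv k)) + 2 * (d : ℝ) ^ 2 * (p k) ^ 2 * (((L ^ k : ℕ) : ℝ) ^ 2 * (CPv k))) + 2 * ((Λ k) * (((L ^ k : ℕ) : ℝ) ^ 2)⁻¹ * ((CD k) + (CD' k))))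
        + (CP k) * (eH k) * ((CD k) + (CD' k)))
    let ε : ℕ → ℝ := fun k => (u k) + (1 + (u k)) * (((s k) + (1 + (s k)⁻¹) * (d * (L : ℝ) / ((L ^ k : ℕ) : ℝ) ^ 2)) * (1 + (CRv k)) + (e₂ k))
      + (1 + (u k)⁻¹) * ((Λv k) * (25 / 4 * ((((L ^ k : ℕ) : ℝ) ^ 2)⁻¹ * ((CGar k) + (CGar' k)))))
    (∀ K, ∑ k ∈ range K, ePV (ΛV k) (CPv k) 1 (ε k) (Real.sqrt (8 * d * (1 + (d : ℝ) ^ 2)) * (((L ^ k : ℕ) : ℝ) * L * m₁ k)) ≤ S) →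
    ∃ Xlim : Matrix (Tor M × Fin d) (Tor M × Fin d) ℂ,
      Tendsto (fun k => effV (L ^ k) M (R k) (GmProj (fine (L ^ k) M) (R k) (LinearMap.ker (avgOp (L ^ k) M (Tsc k)))) (QmL (L ^ k) M (T k)) a)
        atTop (𝓝 Xlim) ∧ Xlim.IsHermitian ∧ (∀ v, 0 ≤ qform Xlim v) ∧
      ∀ φ : Tor M → Fin d → ℂ, Tendsto (fun k => blockSpin (QvL (L ^ k) M (T k))
        (ScV (L ^ k) M (R k) (projG (fine (L ^ k) M) (R k) (LinearMap.ker (avgOp (L ^ k) M (Tsc k))))) φ) atTop (𝓝 (qform Xlim (unc φ))) := by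
  intro eH e₂ ε hS
  have hε : ∀ k, 0 ≤ ε k := fun k =>
    epsStar_nonneg (L ^ k) L (hm k) (hm₁ k) (hΛ k) (hCP k) (hCR k) (hΛv k) (hCRv k) (hCPv k) (hCGar k) (hCGar' k) (hCD k) (hCD' k) (hs k) (ht k) (hu k)
  have hδ : ∀ k, 0 ≤ Real.sqrt (8 * d * (1 + (d : ℝ) ^ 2)) * (((L ^ k : ℕ) : ℝ) * L * m₁ k) := fun k => by have := hm₁ k; positivity
  exact effV_tendsto_of_upper L M R R'
    (fun k => GmProj (fine (L ^ k) M) (R k) (LinearMap.ker (avgOp (L ^ k) M (Tsc k))))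
    (fun k => projG (fine (L ^ k) M) (R k) (LinearMap.ker (avgOp (L ^ k) M (Tsc k))))
    (fun k => projG (fine L (fine (L ^ k) M)) (R' k) (LinearMap.ker ((avgOp (L ^ k) M (Tsc k)).comp (avgOp L (fine (L ^ k) M) (Tsc' k)))))
    T (fun k => frameT L (fine (L ^ k) M) (Tsc' k) (R k))
    (fun k => GmProj_posSemidef _ _ _) (fun k W => projG_eq_qform _ _ _ W) hTcomp hRtr hGtr ha
    ΛV CPv (fun _ => 1) ε (fun k => Real.sqrt (8 * d * (1 + (d : ℝ) ^ 2)) * (((L ^ k : ℕ) : ℝ) * L * m₁ k))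
    hΛV hCPv (fun _ => zero_le_one) hε hδ hS
    (ρV := fun k W => ScV (L ^ k) M (R k) (projG (fine (L ^ k) M) (R k) (LinearMap.ker (avgOp (L ^ k) M (Tsc k)))) W + nsqV M (QvL (L ^ k) M (T k) W))
    (fun k W => add_nonneg (ScV_nonneg (L ^ k) M (R k) (fun W => projG_nonneg (fine (L ^ k) M) (R k) _ W) W) (nsqV_nonneg M _))
    hUBcV hPcV
    (fun k => hONEm_centred_reg (L ^ k) L M hd (hTsc k) (hTsc' k) (hR k) (hR' k) (hT k) (hp k) (hP k) (hm k) (hmis k) (hm₁ k) (hin k) (hcross k)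
      (hΛ k) (hCP k) (hCR k) (hUBc k) (hUBf k) (hPc k) (hPf k) (hREG k) (hΛv k) (hCGar k) (hCGar' k) (hCD k) (hCD' k)
      (hUBfV k) (hPcV k) (hGar k) (hGdiv k) (hREGV k) (hs k) (ht k) (hu k))
    (fun k => hREG_action (L ^ k) M)


/-- **THE SAME UNDER GEOMETRIC DECAY** (`effV_tendsto_of_upper_geom`): uniform bounds `Λ_V k ≤ Λ_V⋆`, `C_Pᵛ k ≤ C_P⋆`, and `ε⋆ k ≤ c_ε·θ^k`,
`√(8d(1+d²))·(L^k·L·m₁ k) ≤ c_δ·θ^k` with `0 ≤ θ < 1` (file C's `epsStar_class_le` gives the first from the class `η_k = c·θ^{2k}`) replace the partial-sum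
hypothesis. [folklore] -/
theorem effV_tendsto_centred_geom (hd : 1 ≤ d)
    (R : (k : ℕ) → Tor (fine (L ^ k) M) → Fin d → (ℂ →L[ℂ] ℂ)) (R' : (k : ℕ) → Tor (fine L (fine (L ^ k) M)) → Fin d → (ℂ →L[ℂ] ℂ))
    (Tsc : (k : ℕ) → Tor (fine (L ^ k) M) → (ℂ →L[ℂ] ℂ)) (Tsc' : (k : ℕ) → Tor (fine L (fine (L ^ k) M)) → (ℂ →L[ℂ] ℂ))
    (T : (k : ℕ) → Tor M → (Fin d → Fin (L ^ k)) → Fin (L ^ k) → Fin d → (ℂ →L[ℂ] ℂ))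
    -- the END's COMP data (transport identities displayed, not proved here)
    (hTcomp : ∀ k, T (k + 1) = compL (L ^ k) L M (T k) (frameT L (fine (L ^ k) M) (Tsc' k) (R k)))
    (hRtr : ∀ k, R (k + 1) = Rtrv (L ^ k) L M (R' k))
    (hGtr : ∀ k, projG (fine (L ^ (k + 1)) M) (R (k + 1)) (LinearMap.ker (avgOp (L ^ (k + 1)) M (Tsc (k + 1))))
      = Gtr (L ^ k) L M (projG (fine L (fine (L ^ k) M)) (R' k) (LinearMap.ker ((avgOp (L ^ k) M (Tsc k)).comp (avgOp L (fine (L ^ k) M) (Tsc' k))))))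
    {a : ℝ} (ha : 0 < a)
    -- unitarity ∕ contractivity ∕ sizes per level
    (hTsc : ∀ k x, Tsc k x ∈ unitary (ℂ →L[ℂ] ℂ)) (hTsc' : ∀ k x, Tsc' k x ∈ unitary (ℂ →L[ℂ] ℂ))
    (hR : ∀ k y μ, R k y μ ∈ unitary (ℂ →L[ℂ] ℂ)) (hR' : ∀ k x μ, R' k x μ ∈ unitary (ℂ →L[ℂ] ℂ)) (hT : ∀ k y j t' μ, ‖T k y j t' μ‖ ≤ 1)
    (p m m₁ : ℕ → ℝ) (hp : ∀ k, 0 ≤ p k)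
    (hP : ∀ k x μ ν, ‖R k x μ * R k (x + unitVec (fine (L ^ k) M) μ) ν - R k x ν * R k (x + unitVec (fine (L ^ k) M) ν) μ‖ ≤ p k)
    (hm : ∀ k, 0 ≤ m k) (hmis : ∀ k y μ j, ‖misv L (fine (L ^ k) M) (R k) (R' k) (Tsc' k) y μ j‖ ≤ m k)
    (hm₁ : ∀ k, 0 ≤ m₁ k)
    (hin : ∀ k (y : Tor (fine (L ^ k) M)) (j : Fin d → Fin L) (μ : Fin d), (j μ : ℕ) + 1 < L →
      ‖R' k (bpt L (fine (L ^ k) M) y j) μ * star (Tsc' k (bpt L (fine (L ^ k) M) y j + unitVec (fine L (fine (L ^ k) M)) μ))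
        - star (Tsc' k (bpt L (fine (L ^ k) M) y j))‖ ≤ m₁ k)
    (hcross : ∀ k (y : Tor (fine (L ^ k) M)) (j : Fin d → Fin L) (μ : Fin d), (j μ : ℕ) + 1 = L →
      ‖R' k (bpt L (fine (L ^ k) M) y j) μ * star (Tsc' k (bpt L (fine (L ^ k) M) y j + unitVec (fine L (fine (L ^ k) M)) μ))
        - star (Tsc' k (bpt L (fine (L ^ k) M) y j)) * R k y μ‖ ≤ m₁ k)
    -- the scalar pair's leaves per level
    (Λ CP CR : ℕ → ℝ) (hΛ : ∀ k, 0 ≤ Λ k) (hCP : ∀ k, 0 ≤ CP k) (hCR : ∀ k, 0 ≤ CR k)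
    (hUBc : ∀ k (ψ : Tor M → ℂ), ∃ f, Qkv (L ^ k) M (Tsc k) f = ψ ∧ Scv (L ^ k) M (R k) f ≤ Λ k * nsqv ψ)
    (hUBf : ∀ k (ψ : Tor M → ℂ), ∃ g, Qkv (L ^ k) M (Tsc k) (Q1v (L ^ k) L M (Tsc' k) g) = ψ ∧ Sfv (L ^ k) L M (R' k) g ≤ Λ k * nsqv ψ)
    (hPc : ∀ k f, qWv (L ^ k) M f ≤ CP k * (Scv (L ^ k) M (R k) f + nsqv (Qkv (L ^ k) M (Tsc k) f)))
    (hPf : ∀ k g, qVv (L ^ k) L M g ≤ CP k * (Sfv (L ^ k) L M (R' k) g + nsqv (Qkv (L ^ k) M (Tsc k) (Q1v (L ^ k) L M (Tsc' k) g))))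
    (hREG : ∀ k (ψ : Tor M → ℂ) f, Qkv (L ^ k) M (Tsc k) f = ψ → (∀ f₂, Qkv (L ^ k) M (Tsc k) f₂ = ψ → Scv (L ^ k) M (R k) f ≤ Scv (L ^ k) M (R k) f₂) →
      rhov (L ^ k) M (R k) f ≤ CR k * (Scv (L ^ k) M (R k) f + nsqv ψ))
    -- the vector leaves per level for `G k := projG (R k) (ker Q_{Tsc k})` on the carriers `QvL (T k)`
    (ΛV Λv CRv CPv CGar CGar' CD CD' : ℕ → ℝ) (hΛV : ∀ k, 0 ≤ ΛV k) (hΛv : ∀ k, 0 ≤ Λv k) (hCRv : ∀ k, 0 ≤ CRv k) (hCPv : ∀ k, 0 ≤ CPv k)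
    (hCGar : ∀ k, 0 ≤ CGar k) (hCGar' : ∀ k, 0 ≤ CGar' k) (hCD : ∀ k, 0 ≤ CD k) (hCD' : ∀ k, 0 ≤ CD' k)
    (hUBcV : ∀ k (φ : Tor M → Fin d → ℂ), ∃ W, QvL (L ^ k) M (T k) W = φ ∧
      ScV (L ^ k) M (R k) (projG (fine (L ^ k) M) (R k) (LinearMap.ker (avgOp (L ^ k) M (Tsc k)))) W ≤ ΛV k * nsqV M φ)
    (hUBfV : ∀ k (φ : Tor M → Fin d → ℂ), ∃ W', QvL (L ^ k) M (T k) (QvL L (fine (L ^ k) M) (frameT L (fine (L ^ k) M) (Tsc' k) (R k)) W') = φ ∧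
      SfV (L ^ k) L M (R' k) (projG (fine L (fine (L ^ k) M)) (R' k)
        (LinearMap.ker ((avgOp (L ^ k) M (Tsc k)).comp (avgOp L (fine (L ^ k) M) (Tsc' k))))) W' ≤ Λv k * nsqV M φ)
    (hPcV : ∀ k W, qWV (L ^ k) M W
      ≤ CPv k * (ScV (L ^ k) M (R k) (projG (fine (L ^ k) M) (R k) (LinearMap.ker (avgOp (L ^ k) M (Tsc k)))) W + nsqV M (QvL (L ^ k) M (T k) W)))
    (hGar : ∀ k W, (((L ^ k : ℕ) : ℝ) ^ d)⁻¹ * (((L ^ k : ℕ) : ℝ) ^ 2 * roughV (L ^ k) M (R k) W)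
      ≤ CGar k * ScV (L ^ k) M (R k) (projG (fine (L ^ k) M) (R k) (LinearMap.ker (avgOp (L ^ k) M (Tsc k)))) W + CGar' k * nsqV M (QvL (L ^ k) M (T k) W))
    (hGdiv : ∀ k W, (((L ^ k : ℕ) : ℝ) ^ d)⁻¹ * (((L ^ k : ℕ) : ℝ) ^ 2 * divSq (fine (L ^ k) M) (R k) W)
      ≤ CD k * ScV (L ^ k) M (R k) (projG (fine (L ^ k) M) (R k) (LinearMap.ker (avgOp (L ^ k) M (Tsc k)))) W + CD' k * nsqV M (QvL (L ^ k) M (T k) W))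
    (hREGV : ∀ k (φ : Tor M → Fin d → ℂ) W, QvL (L ^ k) M (T k) W = φ →
      (∀ W₂, QvL (L ^ k) M (T k) W₂ = φ → ScV (L ^ k) M (R k) (projG (fine (L ^ k) M) (R k) (LinearMap.ker (avgOp (L ^ k) M (Tsc k)))) W
        ≤ ScV (L ^ k) M (R k) (projG (fine (L ^ k) M) (R k) (LinearMap.ker (avgOp (L ^ k) M (Tsc k)))) W₂) →
      rhoV (L ^ k) M (R k) W ≤ CRv k * (ScV (L ^ k) M (R k) (projG (fine (L ^ k) M) (R k) (LinearMap.ker (avgOp (L ^ k) M (Tsc k)))) W + nsqV M φ))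
    (s t u : ℕ → ℝ) (hs : ∀ k, 0 < s k) (ht : ∀ k, 0 < t k) (hu : ∀ k, 0 < u k)
    {ΛVs CPvs cε cδ θ : ℝ} (hΛVs : ∀ k, ΛV k ≤ ΛVs) (hCPvs : ∀ k, CPv k ≤ CPvs) (hθ : 0 ≤ θ) (hθ1 : θ < 1)
    (hδθ : ∀ k, Real.sqrt (8 * d * (1 + (d : ℝ) ^ 2)) * (((L ^ k : ℕ) : ℝ) * L * m₁ k) ≤ cδ * θ ^ k) :
    let eH : ℕ → ℝ := fun k => (((d : ℝ) / 4 + 1 / 2) * ((L : ℝ) / ((L ^ k : ℕ) : ℝ) ^ 2)) * (CR k) * ((Λ k) + 1)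
        + 2 * (Real.sqrt (2 * d * (1 + (d : ℝ) ^ 2)) * (((L ^ k : ℕ) : ℝ) * L * (m₁ k)))
          * Real.sqrt (((Λ k) + (((d : ℝ) / 4 + 1 / 2) * ((L : ℝ) / ((L ^ k : ℕ) : ℝ) ^ 2)) * (CR k) * ((Λ k) + 1)) * ((CP k) * ((Λ k) + 1)))
        + (Real.sqrt (2 * d * (1 + (d : ℝ) ^ 2)) * (((L ^ k : ℕ) : ℝ) * L * (m₁ k))) ^ 2 * ((CP k) * ((Λ k) + 1))
        + 2 * (Real.sqrt d * (((L ^ k : ℕ) : ℝ) * (m k))) * Real.sqrt ((Λ k) * ((CP k) * ((Λ k) + 1)))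
    let e₂ : ℕ → ℝ := fun k => (t k) + 3 * (1 + (t k)⁻¹) * (8 * d * ((((L ^ k : ℕ) : ℝ) ^ 2)⁻¹ * (CRv k)
          + (1 + (m₁ k)) ^ 2 * ((d : ℝ) / 4 * L * ((((L ^ k : ℕ) : ℝ) ^ 2)⁻¹ * (CRv k))) + (m₁ k) ^ 2 * ((CGar k) + (CGar' k))
          + (m₁ k) ^ 2 * (2 * (1 + (d : ℝ) ^ 2) * (L : ℝ) ^ 2 * (((L ^ k : ℕ) : ℝ) ^ 2 * (CPv k))))
        + (d : ℝ) / 2 * (2 * d * ((((L ^ k : ℕ) : ℝ) ^ 2)⁻¹ * (CRv k)) + 2 * (d : ℝ) ^ 2 * (p k) ^ 2 * (((L ^ k : ℕ) : ℝ) ^ 2 * (CPv k)))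
        + (d : ℝ) / 4 * (2 * (2 * d * ((((L ^ k : ℕ) : ℝ) ^ 2)⁻¹ * (CRv k)) + 2 * (d : ℝ) ^ 2 * (p k) ^ 2 * (((L ^ k : ℕ) : ℝ) ^ 2 * (CPv k))) + 2 * ((Λ k) * (((L ^ k : ℕ) : ℝ) ^ 2)⁻¹ * ((CD k) + (CD' k))))
        + (CP k) * (eH k) * ((CD k) + (CD' k)))
    let ε : ℕ → ℝ := fun k => (u k) + (1 + (u k)) * (((s k) + (1 + (s k)⁻¹) * (d * (L : ℝ) / ((L ^ k : ℕ) : ℝ) ^ 2)) * (1 + (CRv k)) + (e₂ k))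
      + (1 + (u k)⁻¹) * ((Λv k) * (25 / 4 * ((((L ^ k : ℕ) : ℝ) ^ 2)⁻¹ * ((CGar k) + (CGar' k)))))
    (∀ k, ε k ≤ cε * θ ^ k) →
    ∃ Xlim : Matrix (Tor M × Fin d) (Tor M × Fin d) ℂ,
      Tendsto (fun k => effV (L ^ k) M (R k) (GmProj (fine (L ^ k) M) (R k) (LinearMap.ker (avgOp (L ^ k) M (Tsc k)))) (QmL (L ^ k) M (T k)) a)
        atTop (𝓝 Xlim) ∧ Xlim.IsHermitian ∧ (∀ v, 0 ≤ qform Xlim v) ∧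
      ∀ φ : Tor M → Fin d → ℂ, Tendsto (fun k => blockSpin (QvL (L ^ k) M (T k))
        (ScV (L ^ k) M (R k) (projG (fine (L ^ k) M) (R k) (LinearMap.ker (avgOp (L ^ k) M (Tsc k))))) φ) atTop (𝓝 (qform Xlim (unc φ))) := by
  intro eH e₂ ε hεθ
  have hε : ∀ k, 0 ≤ ε k := fun k =>
    epsStar_nonneg (L ^ k) L (hm k) (hm₁ k) (hΛ k) (hCP k) (hCR k) (hΛv k) (hCRv k) (hCPv k) (hCGar k) (hCGar' k) (hCD k) (hCD' k) (hs k) (ht k) (hu k)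
  have hδ : ∀ k, 0 ≤ Real.sqrt (8 * d * (1 + (d : ℝ) ^ 2)) * (((L ^ k : ℕ) : ℝ) * L * m₁ k) := fun k => by have := hm₁ k; positivity
  exact effV_tendsto_of_upper_geom L M R R'
    (fun k => GmProj (fine (L ^ k) M) (R k) (LinearMap.ker (avgOp (L ^ k) M (Tsc k))))
    (fun k => projG (fine (L ^ k) M) (R k) (LinearMap.ker (avgOp (L ^ k) M (Tsc k))))
    (fun k => projG (fine L (fine (L ^ k) M)) (R' k) (LinearMap.ker ((avgOp (L ^ k) M (Tsc k)).comp (avgOp L (fine (L ^ k) M) (Tsc' k)))))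
    T (fun k => frameT L (fine (L ^ k) M) (Tsc' k) (R k))
    (fun k => GmProj_posSemidef _ _ _) (fun k W => projG_eq_qform _ _ _ W) hTcomp hRtr hGtr ha
    ΛV CPv (fun _ => 1) ε (fun k => Real.sqrt (8 * d * (1 + (d : ℝ) ^ 2)) * (((L ^ k : ℕ) : ℝ) * L * m₁ k))
    hΛV hΛVs hCPv hCPvs (fun _ => zero_le_one) (fun _ => le_refl (1 : ℝ)) hε hδ hθ hθ1 hεθ hδθ
    (ρV := fun k W => ScV (L ^ k) M (R k) (projG (fine (L ^ k) M) (R k) (LinearMap.ker (avgOp (L ^ k) M (Tsc k)))) W + nsqV M (QvL (L ^ k) M (T k) W))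
    (fun k W => add_nonneg (ScV_nonneg (L ^ k) M (R k) (fun W => projG_nonneg (fine (L ^ k) M) (R k) _ W) W) (nsqV_nonneg M _))
    hUBcV hPcV
    (fun k => hONEm_centred_reg (L ^ k) L M hd (hTsc k) (hTsc' k) (hR k) (hR' k) (hT k) (hp k) (hP k) (hm k) (hmis k) (hm₁ k) (hin k) (hcross k)
      (hΛ k) (hCP k) (hCR k) (hUBc k) (hUBf k) (hPc k) (hPf k) (hREG k) (hΛv k) (hCGar k) (hCGar' k) (hCD k) (hCD' k)
      (hUBfV k) (hPcV k) (hGar k) (hGdiv k) (hREGV k) (hs k) (ht k) (hu k))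
    (fun k => hREG_action (L ^ k) M)

end Summit.QuantumFields.BalabanUV.T4Continuum.VariationalVectorEndCentred

end
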